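import Summits.QuantumFields.YangMills.Theorems.UnitScaleTiltProp7LocalHolderToAxialLetter
import Summits.QuantumFields.YangMills.Theorems.UnitScaleTiltProp7OmegaOneLODForm
import Summits.QuantumFields.YangMills.Theorems.UnitScaleTiltProp7ResolventHolderRowMember
import HarnessLib

/-!
# Route `UnitScaleTilt`, crux K1 «MinimiserStabilityRegPr» (stmt-QuantumFields-19200), EX row (5) `h3` (STOREY H), pipeline (ii) := «H2-LOC», brick **C6 / F3 — THE KNIT: THE WINDOWED
# COVER-AXIAL ½-HÖLDER LETTER OF `ω₁(A)` FROM THE LOCAL LETTERS** (★CHAIR WORD №60 (3) C6, №63 (1)–(3): road of record = the LOD three-piece form; `hUsup` admitted as a displayed letter).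
# OUTPUT = H8-R′ v2 ✓`Prop7StoreyHGradientRowOfWindowedHolder.h3_of_windowedHolderLetter_allMembers`' ONE displayed letter `hHωw` (= BRIDGE v2 ✓`Prop7AxialHolderBridge` §3 `hax` at
# `ω := ω₁ A := R_S(D*_{U₀}(G_{Δx}(toL2 A)))`, `Hω := C·‖A‖`) for EVERY `A`, with an explicit K-free constant `C` in the letters' constants.
# PROOF = F2 ✓∕⧗`Prop7OmegaOneLODForm.omega_one_three_pieces` (`ω₁ = w + (u − w) − G_a(Tc(u))`, `u = G_a(D*x)`, `w = G_1(D*x)`, `x = toL2 A`) + C6-PLUMBING ✓`Prop7LocalHolderToAxialLetter`: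
# piece `w` by (P1) `hax_of_localHolder` from the FROZEN local Hölder letter `hHlocV` (857ccd79) with sups `hWsup` (a03f6c18) and `‖x‖ ≤ √2‖A‖`; piece `u − w` by (P2) `hax_of_etaGradient` with the
# η-gradient sup from T1 ✓`gradient_decay_of_decay_allMembers` at `κ := 0` (equation F2 `sub_carrier_equation`; sups `hUsup`, `hWsup`, the penalty letter `hPen`); piece `G_a(Tc(u))` by (P2) with the
# gradient∕value letters `hDw`∕`hGw` of `G_a` on the sup-bounded coarse source (`hsrc`); summed by (P0) `hax_add`∕`hax_sub`.

Cell `ym3-torus` (HUMAN RULING D-0037; rung R3 = SU(2) YM₃ on T³ — NOT d = 4, NOT infinite volume, NOT a mass gap, NOT Clay).  Width seat `ym3-torus-px13` (gen 17);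
`--supports stmt-QuantumFields-19200 --as helper`; count-neutral; THEOREMS ONLY (0 `def`, 0 `sorry`, default heartbeats).

DISPLAYED LETTERS (★★OWNER RULING №42 ∕ №52; every one by name, none conclusion-shaped; PIN TABLE of `LOCATE-C6-knit-px13g17.md` §3):
`RegPr` (`0 < ε₀ ≤ 1`, print's (8)); the LOD lift letters `Q″ hseq ι T hT G hAG hGA hRS hker` VERBATIM (✓`Prop7ZeroModesOrthKerTopMean` §LOD; the R-editions' `Lift` antecedent); the slot class
`PosOnto … aT Δx U₀` + `hΔs`∕`hΔ` (S48–S50); `hHlocV` = px19 g16's FROZEN text 857ccd79b0071bdc (RECORD 17dq; supplier H2-LOC C1–C5; flat case ✓`exists_localHolder_flat_member`), window `48ε₀ ≤ θ₀`;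
`hWsup` = FROZEN text a03f6c184c689677 (supplier re-homed CHAIR №62), window `ε₀ ≤ θw`; `hUsup` = THIS FILE's frozen text (sup of `u = G_a(D*x)`; CHAIR №63 (2): displayed, supplier road (β) =
the `hWsup` programme for the LOD operator, (α) adjointness + `hDw` at `κ > 0`); `hPen` (sup of the bare penalty `a•T(ι(Q″g))` from `sup g`; supplier ✓`norm_equiv_penalty_apply_le_blockCut` + the
one-block `L² ≤ √(c₀ℓ³)·sup` at the pin `c₁ = c₀ℓ³`); `hcompl`∕`hsrc` (print's complementary projector in source form and its sup; supplier P3v ✓`sub_projR_eq_G_lift_coeffSum` ∕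
✓`norm_equiv_complementary_source_apply_le`); `hGw`∕`hDw` (value∕gradient letters of `G_a` on sup-bounded site sources at rate `κ = 0`; suppliers W4 `hGw` families ∕ ✓`hDw_of_letters_allMembers`);
`hsmall` = T1's margin (H7-R's form).  HONEST SCOPE: a knit of displayed letters through landed conversions — NO estimate of print is proved here; `hHlocV`, `hWsup`, `hUsup`, `h3`, norm_G, EX,
19200 and the rung are NOT proved; the Yang–Mills mass gap is NOT proved.

References: T. Bałaban, CMP **99** (1985) 389–434 [Balaban1985BackgroundPropagators] (Thm 3.1 (3.42)–(3.43) pp.397–398, (3.21)–(3.25) p.394, (3.151)–(3.152) pp.425–426, (3.35) p.396);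
CMP **96** (1984) 223–250 [Balaban1984PropagatorsII] ((1.9) p.226, Lemma 2.1 (2.61)–(2.63) p.234); CMP **98** (1985) 17–51 [Balaban1985Averaging] (pp.24–25); CMP **102** (1985) 277–309
[Balaban1985Variational] ((117) p.295, (138)–(139) p.299).
-/

set_option autoImplicit false

noncomputable section

open scoped BigOperators Matrix.Norms.L2Operator InnerProductSpace ComplexConjugate Matrix

namespace Summit.QuantumFields.YangMills.Theorems.Prop7OmegaOneAxialHolderKnit

open Literature.MathematicalPhysics.QuantumFieldTheory.Balaban1983to89
open Literature.MathematicalPhysics.QuantumFieldTheory.Balaban1983to89.T3ContinuumYM3Torus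
open T4Continuum BlockAveraging
open BlockAveraging (Idx off)
open B7Prop1Explicit (disp)
open B10Eq27TorusAxialLog (axialT holT transl)
open B7TransferAnalyticMean (meanCLM)
open B4Sect5Torus (TSite tdist)
open B9SectCLatticeCarrier (Bond)
open B9Eq311L2Pairing (WL2)
open B11Eq103H1Complex (SiteL2K BondL2K projR greenK apply_greenK)
open B5Eq118OneStroke (iterBlockOf)
open Summit.QuantumFields.YangMills.Theorems.Prop8Chart (emlIterU)
open T3PrintedRegularMinimiser (RegPr)
open T3SectALandauChart (bgUnits)
open Summit.QuantumFields.YangMills.Theorems.Prop7SectET3Transport (periodsT3 siteEquiv bondEquiv bgOfCfg)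
open Summit.QuantumFields.YangMills.Theorems.Prop7SectET3HilbertLetters (W₂ frobEquiv toL2 toL2S DL2 DstarL2 covLapSite toL2_apply)
open Summit.QuantumFields.YangMills.Theorems.Prop7SectET3GaugeProjector (NS RS)
open Summit.QuantumFields.YangMills.Theorems.Prop7SectET3CurvedPropagators (PosOnto GT)
open Summit.QuantumFields.YangMills.Theorems.Prop7RieszTauFrobNorm (norm_frobEquiv_symm_le)
open Summit.QuantumFields.YangMills.Theorems.Prop7CurvedMemberLocalGradient (exists_curved_localGradient)
open Summit.QuantumFields.YangMills.Theorems.AxialGaugeChartGlue (norm_bgOfCfg_axialT_sub_le)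
open Summit.QuantumFields.YangMills.Theorems.Prop7PoissonGradientDecayAllMembers (gradient_decay_of_decay_allMembers)
open Summit.QuantumFields.YangMills.Theorems.Prop7ResolventHolderRowMember (covLapSite_add_pos)
open Summit.QuantumFields.YangMills.Theorems.Prop7LocalHolderToAxialLetter (hax_add hax_sub hax_of_localHolder hax_of_etaGradient)
open Summit.QuantumFields.YangMills.Theorems.Prop7OmegaOneLODForm (sub_carrier_equation omega_one_three_pieces)
open Summit.QuantumFields.YangMills.Theorems.CoverSites

variable (F : T3Family) {n K : ℕ} (hnK : n ≤ K) {c₀ c₁ cB : ℝ} [Fact (0 < c₀)] [Fact (0 < c₁)] [Fact (0 < cB)]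
  (U₀ : GaugeField (F.P K) 0 (Matrix.specialUnitaryGroup (Fin 2) ℂ))
  (Q'' : SiteL2K ℂ 3 (periodsT3 F K) c₀ W₂ →ₗ[ℂ] (Site (F.P K) (K - n) → Matrix (Fin 2) (Fin 2) ℂ))
  (hseq : ∀ lam : Site (F.P K) 0 → Matrix (Fin 2) (Fin 2) ℂ, ∃ ns : (j : ℕ) → Site (F.P K) j → Matrix (Fin 2) (Fin 2) ℂ, ns 0 = lam ∧
      (∀ (j : ℕ) (y : Site (F.P K) (j + 1)), ns (j + 1) y = ns j (emb y) - meanCLM (Idx (F.P K)) (Matrix (Fin 2) (Fin 2) ℂ) fun i : Idx (F.P K) =>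
        ns j (emb y) - ((holT (emlIterU j (bgUnits F K U₀)) (emb y) (stairWord i.2.1 (off i.1)) : (Matrix (Fin 2) (Fin 2) ℂ)ˣ) : Matrix (Fin 2) (Fin 2) ℂ) *
          ns j (transl (emb y) (disp (stairWord i.2.1 (off i.1)))) * (((holT (emlIterU j (bgUnits F K U₀)) (emb y) (stairWord i.2.1 (off i.1)))⁻¹ : (Matrix (Fin 2) (Fin 2) ℂ)ˣ) : Matrix (Fin 2) (Fin 2) ℂ)) ∧
      ns (K - n) = Q'' (toL2S F K c₀ lam))
  (ι : (Site (F.P K) (K - n) → Matrix (Fin 2) (Fin 2) ℂ) →ₗ[ℂ] SiteL2K ℂ 3 (periodsT3 F n) c₁ W₂)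
  (T : SiteL2K ℂ 3 (periodsT3 F n) c₁ W₂ →ₗ[ℂ] SiteL2K ℂ 3 (periodsT3 F K) c₀ W₂)
  (hT : ∀ (l : SiteL2K ℂ 3 (periodsT3 F K) c₀ W₂) (f : SiteL2K ℂ 3 (periodsT3 F n) c₁ W₂), ⟪ι (Q'' l), f⟫_ℂ = ⟪l, T f⟫_ℂ)
  {a : ℝ}
  (G : SiteL2K ℂ 3 (periodsT3 F K) c₀ W₂ →ₗ[ℂ] SiteL2K ℂ 3 (periodsT3 F K) c₀ W₂)
  (hAG : ∀ f, covLapSite F n K c₀ U₀ (G f) + (a : ℂ) • T (ι (Q'' (G f))) = f)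
  (hGA : ∀ u, G (covLapSite F n K c₀ U₀ u + (a : ℂ) • T (ι (Q'' u))) = u)
  (hRS : RS F n K hnK c₀ cB U₀ = projR (covLapSite F n K c₀ U₀) Q'')
  (hker : LinearMap.ker Q'' ≤ NS F n K hnK c₀ cB U₀)

omit [Fact (0 < c₀)] in
/-- `‖(toL2 A) q‖_{W₂} ≤ √2·‖A‖` at every charted bond (Frobenius vs operator norm, ✓`norm_frobEquiv_symm_le`; `‖A b‖ ≤ ‖A‖`). [cite: Balaban1985BackgroundPropagators, (3.11) p.392] -/
theorem norm_equiv_toL2_le (A : PBond (F.P K) 0 → Matrix (Fin 2) (Fin 2) ℂ) (q : Bond 3 (periodsT3 F K)) :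
    ‖WL2.equiv ℂ (fun _ : Bond 3 (periodsT3 F K) => c₀) W₂ (toL2 F K c₀ A) q‖ ≤ Real.sqrt 2 * ‖A‖ := by
  rw [toL2_apply]
  exact (norm_frobEquiv_symm_le _).trans (mul_le_mul_of_nonneg_left (norm_le_pi_norm A _) (Real.sqrt_nonneg _))

-- HEARTBEAT rule (README): the knit's statement carries two frozen ∀-letters and a closed K-free constant; it elaborates at the default budget on the farm but is
-- budgeted decl-locally against the CI cliff (disclosed; never file-global).
include hseq hT hAG hGA hRS hker in
set_option maxHeartbeats 400000 in
/-- ★★★ **THE KNIT — H8-R′ v2's `hHωw` SUPPLIED MODULO THE LOCAL LETTERS.**  At every member, for `RegPr F n K ε₀ U₀` (`0 < ε₀ ≤ 1`) and the displayed letters of the module docstring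
(`hHlocV` 857ccd79, `hWsup` a03f6c18, `hUsup`, `hPen`, `hcompl`∕`hsrc`, `hGw`∕`hDw`, `hsmall`, the LOD lift letters, the slot class), for EVERY `A`: the windowed cover-axial ½-Hölder
letter of `ω₁ A = R_S(D*_{U₀}(G_{Δx}(toL2 A)))` on the `4ℓ+1` balls of the `L³`-fold cover, with the constant `C·‖A‖`, `C` K-free and explicit in the letters' constants.
PROOF: `ω₁ A = w + (u − w) − G_a(Tc(cs u))` (F2) with `u = G_a(D*x)`, `w = G_1(D*x)` (✓`covLapSite_add_pos`, lit `apply_greenK`), `x = toL2 A`, `‖x‖ ≤ √2‖A‖`; piece `w`: P1 at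
`(w, 1•w, x)`; piece `u − w`: T1 at `κ := 0` on F2's `sub_carrier_equation` then P2; piece `G_a(Tc(cs u))`: `hsrc`, `hGw`, `hDw`, P2; sum by P0; constants collected by `ring`.
[cite: Balaban1985BackgroundPropagators, Thm 3.1 (3.42)–(3.43) pp.397–398, (3.21)–(3.25) p.394, (3.151)–(3.152) pp.425–426; Balaban1984PropagatorsII, (1.9) p.226; Balaban1985Averaging, pp.24-25] -/
theorem hax_omega_one {ε₀ : ℝ} (hε₀ : 0 < ε₀) (hε1 : ε₀ ≤ 1) (hreg : RegPr F n K ε₀ U₀) (ha : 0 ≤ a)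
    {aT : ℝ} {Δx : GaugeField (F.P K) 0 (Matrix.specialUnitaryGroup (Fin 2) ℂ) → (BondL2K ℂ 3 (periodsT3 F K) c₀ W₂ →ₗ[ℂ] BondL2K ℂ 3 (periodsT3 F K) c₀ W₂)}
    (hp : PosOnto F n K hnK c₀ cB aT Δx U₀) (hΔs : (Δx U₀).IsSymmetric) (hΔ : ∀ l ∈ NS F n K hnK c₀ cB U₀, Δx U₀ (DL2 F n K c₀ U₀ l) = 0)
    {Ch θ₀ : ℝ} (hθ : 48 * ε₀ ≤ θ₀)
    (hHlocV : ∀ (F : T3Family) (n K : ℕ) (c₀ : ℝ) [Fact (0 < c₀)] (V : GaugeField (F.P K) 0 (Matrix.specialUnitaryGroup (Fin 2) ℂ))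
      (u q : SiteL2K ℂ 3 (periodsT3 F K) c₀ W₂) (f : BondL2K ℂ 3 (periodsT3 F K) c₀ W₂) (x : TSite 3 (periodsT3 F K)) (Mu Mf Mq δ : ℝ),
      0 ≤ Mu → 0 ≤ Mf → 0 ≤ Mq → 0 ≤ δ → (F.L : ℝ) ^ (K - n) * δ ≤ θ₀ →
      covLapSite F n K c₀ V u + q = DstarL2 F n K c₀ V f →
      (∀ y, tdist (periodsT3 F K) x y ≤ 4 * (F.L : ℝ) ^ (K - n) + 1 → ‖WL2.equiv ℂ (fun _ : TSite 3 (periodsT3 F K) => c₀) W₂ u y‖ ≤ Mu) →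
      (∀ (y : TSite 3 (periodsT3 F K)) (μ : Fin 3), tdist (periodsT3 F K) x y ≤ 4 * (F.L : ℝ) ^ (K - n) + 1 →
        ‖WL2.equiv ℂ (fun _ : Bond 3 (periodsT3 F K) => c₀) W₂ f (y, μ)‖ ≤ Mf) →
      (∀ y, tdist (periodsT3 F K) x y ≤ 4 * (F.L : ℝ) ^ (K - n) + 1 → ‖WL2.equiv ℂ (fun _ : TSite 3 (periodsT3 F K) => c₀) W₂ q y‖ ≤ Mq) →
      (∀ (y : TSite 3 (periodsT3 F K)) (μ : Fin 3), tdist (periodsT3 F K) x y ≤ 4 * (F.L : ℝ) ^ (K - n) + 1 →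
        ‖((bgOfCfg F K V (y, μ) : (Matrix (Fin 2) (Fin 2) ℂ)ˣ) : Matrix (Fin 2) (Fin 2) ℂ) - 1‖ ≤ δ) →
      ∀ x' : TSite 3 (periodsT3 F K), tdist (periodsT3 F K) x x' ≤ (F.L : ℝ) ^ (K - n) →
        ‖WL2.equiv ℂ (fun _ : TSite 3 (periodsT3 F K) => c₀) W₂ u x' - WL2.equiv ℂ (fun _ : TSite 3 (periodsT3 F K) => c₀) W₂ u x‖
          ≤ Ch * (Mu + Mf + Mq) * (tdist (periodsT3 F K) x x' / ((F.L : ℝ) ^ (K - n))) ^ ((1 : ℝ) / 2))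
    {Cw θw : ℝ} (hCw : 0 ≤ Cw) (hθw : ε₀ ≤ θw)
    (hWsup : ∀ (F : T3Family) (n K : ℕ) (c₀ : ℝ) [Fact (0 < c₀)] (ε₀ : ℝ) (U₀ : GaugeField (F.P K) 0 (Matrix.specialUnitaryGroup (Fin 2) ℂ)),
      0 ≤ ε₀ → ε₀ ≤ θw → RegPr F n K ε₀ U₀ →
      ∀ (w : SiteL2K ℂ 3 (periodsT3 F K) c₀ W₂) (x : BondL2K ℂ 3 (periodsT3 F K) c₀ W₂) (X : ℝ), 0 ≤ X →
      covLapSite F n K c₀ U₀ w + ((1 : ℝ) : ℂ) • w = DstarL2 F n K c₀ U₀ x →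
      (∀ b : Bond 3 (periodsT3 F K), ‖WL2.equiv ℂ (fun _ : Bond 3 (periodsT3 F K) => c₀) W₂ x b‖ ≤ X) →
      ∀ y : TSite 3 (periodsT3 F K), ‖WL2.equiv ℂ (fun _ : TSite 3 (periodsT3 F K) => c₀) W₂ w y‖ ≤ Cw * X)
    {Cu : ℝ} (hCu : 0 ≤ Cu)
    (hUsup : ∀ (x : BondL2K ℂ 3 (periodsT3 F K) c₀ W₂) (X : ℝ), 0 ≤ X →
      (∀ b : Bond 3 (periodsT3 F K), ‖WL2.equiv ℂ (fun _ : Bond 3 (periodsT3 F K) => c₀) W₂ x b‖ ≤ X) →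
      ∀ y : TSite 3 (periodsT3 F K), ‖WL2.equiv ℂ (fun _ : TSite 3 (periodsT3 F K) => c₀) W₂ (G (DstarL2 F n K c₀ U₀ x)) y‖ ≤ Cu * X)
    {Cpen : ℝ} (hCpen : 0 ≤ Cpen)
    (hPen : ∀ (g : SiteL2K ℂ 3 (periodsT3 F K) c₀ W₂) (Gb : ℝ), 0 ≤ Gb →
      (∀ y : TSite 3 (periodsT3 F K), ‖WL2.equiv ℂ (fun _ : TSite 3 (periodsT3 F K) => c₀) W₂ g y‖ ≤ Gb) →
      ∀ y : TSite 3 (periodsT3 F K), ‖WL2.equiv ℂ (fun _ : TSite 3 (periodsT3 F K) => c₀) W₂ ((a : ℂ) • T (ι (Q'' g))) y‖ ≤ Cpen * Gb)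
    {Cc : Type*} (cs : SiteL2K ℂ 3 (periodsT3 F K) c₀ W₂ → Cc) (Tc : Cc → SiteL2K ℂ 3 (periodsT3 F K) c₀ W₂)
    (hcompl : ∀ g : SiteL2K ℂ 3 (periodsT3 F K) c₀ W₂, g - RS F n K hnK c₀ cB U₀ g = G (Tc (cs g)))
    {Csrc : ℝ} (hCsrc : 0 ≤ Csrc)
    (hsrc : ∀ (g : SiteL2K ℂ 3 (periodsT3 F K) c₀ W₂) (Vb : ℝ), 0 ≤ Vb →
      (∀ y : TSite 3 (periodsT3 F K), ‖WL2.equiv ℂ (fun _ : TSite 3 (periodsT3 F K) => c₀) W₂ g y‖ ≤ Vb) →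
      ∀ y : TSite 3 (periodsT3 F K), ‖WL2.equiv ℂ (fun _ : TSite 3 (periodsT3 F K) => c₀) W₂ (Tc (cs g)) y‖ ≤ Csrc * Vb)
    {Bw Rw : ℝ} (hBw : 0 ≤ Bw) (hRw : 0 ≤ Rw)
    (hGw : ∀ (f : SiteL2K ℂ 3 (periodsT3 F K) c₀ W₂) (Fb : ℝ), 0 ≤ Fb →
      (∀ x' : Site (F.P K) 0, ‖WL2.equiv ℂ (fun _ : TSite 3 (periodsT3 F K) => c₀) W₂ f (siteEquiv F K x')‖ ≤ Fb) →
      ∀ x' : Site (F.P K) 0, ‖WL2.equiv ℂ (fun _ : TSite 3 (periodsT3 F K) => c₀) W₂ (G f) (siteEquiv F K x')‖ ≤ Bw * Fb)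
    (hDw : ∀ (f : SiteL2K ℂ 3 (periodsT3 F K) c₀ W₂) (Fb : ℝ), 0 ≤ Fb →
      (∀ x' : Site (F.P K) 0, ‖WL2.equiv ℂ (fun _ : TSite 3 (periodsT3 F K) => c₀) W₂ f (siteEquiv F K x')‖ ≤ Fb) →
      ∀ b : PBond (F.P K) 0, ‖WL2.equiv ℂ (fun _ : Bond 3 (periodsT3 F K) => c₀) W₂ (DL2 F n K c₀ U₀ (G f)) (bondEquiv F K b)‖ ≤ Rw * Fb)
    (hsmall : exists_curved_localGradient.choose * ((48 * ε₀) * (6 * Real.sqrt 2 * Real.sqrt 10 + 6 * Real.sqrt 2)) ≤ 1 / 2) :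
    ∀ A : PBond (F.P K) 0 → Matrix (Fin 2) (Fin 2) ℂ,
    ∀ (ct : Site ((F.cover 3).P K) 0) (yt yt' : TSite 3 (periodsT3 (F.cover 3) K)),
      tdist (periodsT3 (F.cover 3) K) (siteEquiv (F.cover 3) K ct) yt ≤ 4 * (F.L : ℝ) ^ (K - n) + 1 →
      tdist (periodsT3 (F.cover 3) K) (siteEquiv (F.cover 3) K ct) yt' ≤ 4 * (F.L : ℝ) ^ (K - n) + 1 →
      tdist (periodsT3 (F.cover 3) K) yt yt' ≤ (F.L : ℝ) ^ (K - n) →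
      ‖WL2.equiv ℂ (fun _ : TSite 3 (periodsT3 (F.cover 3) K) => c₀) W₂
            (toL2S (F.cover 3) K c₀ (fun zt => ((axialT (U₀ ∘ projBond (F.P K) 3 0) ct zt : Matrix.specialUnitaryGroup (Fin 2) ℂ) : Matrix (Fin 2) (Fin 2) ℂ)
              * (toL2S F K c₀).symm (RS F n K hnK c₀ cB U₀ (DstarL2 F n K c₀ U₀ (GT F n K hnK c₀ cB aT Δx U₀ (toL2 F K c₀ A)))) (proj (F.P K) 3 0 zt)
              * star ((axialT (U₀ ∘ projBond (F.P K) 3 0) ct zt : Matrix.specialUnitaryGroup (Fin 2) ℂ) : Matrix (Fin 2) (Fin 2) ℂ))) yt'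
          - WL2.equiv ℂ (fun _ : TSite 3 (periodsT3 (F.cover 3) K) => c₀) W₂
            (toL2S (F.cover 3) K c₀ (fun zt => ((axialT (U₀ ∘ projBond (F.P K) 3 0) ct zt : Matrix.specialUnitaryGroup (Fin 2) ℂ) : Matrix (Fin 2) (Fin 2) ℂ)
              * (toL2S F K c₀).symm (RS F n K hnK c₀ cB U₀ (DstarL2 F n K c₀ U₀ (GT F n K hnK c₀ cB aT Δx U₀ (toL2 F K c₀ A)))) (proj (F.P K) 3 0 zt)
              * star ((axialT (U₀ ∘ projBond (F.P K) 3 0) ct zt : Matrix.specialUnitaryGroup (Fin 2) ℂ) : Matrix (Fin 2) (Fin 2) ℂ))) yt‖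
        ≤ ((Real.sqrt 2 * (Ch * (2 * Cw + 1)
          + 3 * Real.sqrt 10 * (2 * ((exists_curved_localGradient.choose * ((Cu + Cw) * (2 + 2 * Real.sqrt 2 * (4 * ε₀ * (3 + 2457 * norm_bgOfCfg_axialT_sub_le.choose)) + (24 * Real.sqrt 10 + 48) * (48 * ε₀) ^ 2)
              + (Cpen * Cu + Cw))) + 2 * Real.sqrt 2 * (48 * ε₀) * (Cu + Cw)) + 2 * Real.sqrt 2 * (48 * ε₀) * (Cu + Cw))
          + 3 * Real.sqrt 10 * (Rw * (Csrc * Cu) + 2 * Real.sqrt 2 * (48 * ε₀) * (Bw * (Csrc * Cu)))) * ‖A‖)) * (tdist (periodsT3 (F.cover 3) K) yt yt' / ((F.L : ℝ) ^ (K - n))) ^ ((1 : ℝ) / 2) := by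
  intro A
  have hCg := exists_curved_localGradient.choose_spec.1
  have hCax := norm_bgOfCfg_axialT_sub_le.choose_spec.1
  -- the datum `x = toL2 A` and its sup `X = √2‖A‖`
  set x : BondL2K ℂ 3 (periodsT3 F K) c₀ W₂ := toL2 F K c₀ A with hx
  set X : ℝ := Real.sqrt 2 * ‖A‖ with hX
  have hX0 : 0 ≤ X := by positivity
  have hxX : ∀ b : Bond 3 (periodsT3 F K), ‖WL2.equiv ℂ (fun _ : Bond 3 (periodsT3 F K) => c₀) W₂ x b‖ ≤ X := fun b => norm_equiv_toL2_le F A b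
  -- the H2-LOC carrier `w = G_1(D*x)` and its sup
  have hpos1 := covLapSite_add_pos F n K c₀ U₀ (zero_lt_one : (0 : ℝ) < 1)
  set w : SiteL2K ℂ 3 (periodsT3 F K) c₀ W₂ :=
    greenK (covLapSite F n K c₀ U₀ + ((1 : ℝ) : ℂ) • (LinearMap.id : SiteL2K ℂ 3 (periodsT3 F K) c₀ W₂ →ₗ[ℂ] SiteL2K ℂ 3 (periodsT3 F K) c₀ W₂)) hpos1
      (DstarL2 F n K c₀ U₀ x) with hw
  have hweq : covLapSite F n K c₀ U₀ w + ((1 : ℝ) : ℂ) • w = DstarL2 F n K c₀ U₀ x := by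
    have h := apply_greenK hpos1 (DstarL2 F n K c₀ U₀ x)
    rw [LinearMap.add_apply, LinearMap.smul_apply, LinearMap.id_apply] at h
    exact h
  have hMw : ∀ y, ‖WL2.equiv ℂ (fun _ : TSite 3 (periodsT3 F K) => c₀) W₂ w y‖ ≤ Cw * X := hWsup F n K c₀ ε₀ U₀ hε₀.le hθw hreg w x X hX0 hweq hxX
  have hMw0 : 0 ≤ Cw * X := by positivity
  -- the LOD resolvent `u = G_a(D*x)` and its sup
  set u : SiteL2K ℂ 3 (periodsT3 F K) c₀ W₂ := G (DstarL2 F n K c₀ U₀ x) with hu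
  have hMu : ∀ y, ‖WL2.equiv ℂ (fun _ : TSite 3 (periodsT3 F K) => c₀) W₂ u y‖ ≤ Cu * X := hUsup x X hX0 hxX
  have hMu0 : 0 ≤ Cu * X := by positivity
  -- PIECE 1: `w` by (P1)
  have hq1 : ∀ y, ‖WL2.equiv ℂ (fun _ : TSite 3 (periodsT3 F K) => c₀) W₂ (((1 : ℝ) : ℂ) • w) y‖ ≤ Cw * X := fun y => by
    rw [Complex.ofReal_one, one_smul]; exact hMw y
  have h1 := hax_of_localHolder F n K c₀ hε₀.le hθ hHlocV U₀ hreg w (((1 : ℝ) : ℂ) • w) x hweq hMw0 hMw0 hX0 hMw hq1 hxX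
  -- PIECE 2: `p = u − w` by T1 at `κ := 0` then (P2)
  have hEq2 := sub_carrier_equation F U₀ Q'' ι T G hAG x w hweq
  have hAp : ∀ x' : Site (F.P K) 0, ‖WL2.equiv ℂ (fun _ : TSite 3 (periodsT3 F K) => c₀) W₂ (u - w) (siteEquiv F K x')‖
      ≤ (Cu * X + Cw * X) * Real.exp (-(0 * (Site.tdist (P := F.P K) (iterBlockOf (K - n) x') (0 : Site (F.P K) (K - n)) : ℝ))) := by
    intro x'
    rw [zero_mul, neg_zero, Real.exp_zero, mul_one, WL2.equiv_sub, Pi.sub_apply]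
    exact (norm_sub_le _ _).trans (add_le_add (hMu _) (hMw _))
  have hAq : ∀ x' : Site (F.P K) 0, ‖WL2.equiv ℂ (fun _ : TSite 3 (periodsT3 F K) => c₀) W₂ ((a : ℂ) • T (ι (Q'' u)) - w) (siteEquiv F K x')‖
      ≤ (Cpen * (Cu * X) + Cw * X) * Real.exp (-(0 * (Site.tdist (P := F.P K) (iterBlockOf (K - n) x') (0 : Site (F.P K) (K - n)) : ℝ))) := by
    intro x'
    rw [zero_mul, neg_zero, Real.exp_zero, mul_one, WL2.equiv_sub, Pi.sub_apply]
    exact (norm_sub_le _ _).trans (add_le_add (hPen u (Cu * X) hMu0 hMu _) (hMw _))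
  have hsmall0 : exists_curved_localGradient.choose * ((48 * ε₀) * (6 * Real.sqrt 2 * Real.sqrt 10 + 6 * Real.sqrt 2)) * Real.exp (51 * 0) ≤ 1 / 2 := by
    rw [mul_zero, Real.exp_zero, mul_one]; exact hsmall
  have hT1 := gradient_decay_of_decay_allMembers F n K hε₀ hε1 U₀ hreg c₀ (u - w) ((a : ℂ) • T (ι (Q'' u)) - w) hEq2 (0 : Site (F.P K) (K - n))
    (κ := 0) le_rfl (by positivity) (by positivity) hAp hAq hsmall0
  -- the η-gradient sup of `p`, at every charted bond
  have hG2 : ∀ b : Bond 3 (periodsT3 F K), ‖WL2.equiv ℂ (fun _ : Bond 3 (periodsT3 F K) => c₀) W₂ (DL2 F n K c₀ U₀ (u - w)) b‖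
      ≤ 2 * ((exists_curved_localGradient.choose *
            ((Cu * X + Cw * X) * (2 + 2 * Real.sqrt 2 * (4 * ε₀ * (3 + 2457 * norm_bgOfCfg_axialT_sub_le.choose)) + (24 * Real.sqrt 10 + 48) * (48 * ε₀) ^ 2)
              + (Cpen * (Cu * X) + Cw * X))
          + 2 * Real.sqrt 2 * (48 * ε₀) * (Cu * X + Cw * X))) := by
    intro b
    have h := hT1 ((bondEquiv F K).symm b)
    rw [Equiv.apply_symm_apply] at h
    simp only [mul_zero, zero_mul, neg_zero, Real.exp_zero, mul_one] at h
    exact h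
  have hG20 : 0 ≤ 2 * ((exists_curved_localGradient.choose *
            ((Cu * X + Cw * X) * (2 + 2 * Real.sqrt 2 * (4 * ε₀ * (3 + 2457 * norm_bgOfCfg_axialT_sub_le.choose)) + (24 * Real.sqrt 10 + 48) * (48 * ε₀) ^ 2)
              + (Cpen * (Cu * X) + Cw * X))
          + 2 * Real.sqrt 2 * (48 * ε₀) * (Cu * X + Cw * X))) := by positivity
  have hMp2 : ∀ y, ‖WL2.equiv ℂ (fun _ : TSite 3 (periodsT3 F K) => c₀) W₂ (u - w) y‖ ≤ Cu * X + Cw * X := fun y => by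
    rw [WL2.equiv_sub, Pi.sub_apply]; exact (norm_sub_le _ _).trans (add_le_add (hMu _) (hMw _))
  have h2 := hax_of_etaGradient F n K c₀ hε₀.le U₀ hreg (u - w) hG20 (by positivity : (0 : ℝ) ≤ Cu * X + Cw * X) hG2 hMp2
  -- PIECE 3: `r = G_a(Tc(cs u))` by `hsrc`, `hGw`, `hDw`, (P2)
  have hF3 : ∀ y, ‖WL2.equiv ℂ (fun _ : TSite 3 (periodsT3 F K) => c₀) W₂ (Tc (cs u)) y‖ ≤ Csrc * (Cu * X) := hsrc u (Cu * X) hMu0 hMu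
  have hF30 : 0 ≤ Csrc * (Cu * X) := by positivity
  have hMp3 : ∀ y, ‖WL2.equiv ℂ (fun _ : TSite 3 (periodsT3 F K) => c₀) W₂ (G (Tc (cs u))) y‖ ≤ Bw * (Csrc * (Cu * X)) := fun y => by
    have h := hGw (Tc (cs u)) _ hF30 (fun x' => hF3 _) ((siteEquiv F K).symm y)
    rwa [Equiv.apply_symm_apply] at h
  have hG3 : ∀ b : Bond 3 (periodsT3 F K), ‖WL2.equiv ℂ (fun _ : Bond 3 (periodsT3 F K) => c₀) W₂ (DL2 F n K c₀ U₀ (G (Tc (cs u)))) b‖ ≤ Rw * (Csrc * (Cu * X)) := fun b => by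
    have h := hDw (Tc (cs u)) _ hF30 (fun x' => hF3 _) ((bondEquiv F K).symm b)
    rwa [Equiv.apply_symm_apply] at h
  have h3 := hax_of_etaGradient F n K c₀ hε₀.le U₀ hreg (G (Tc (cs u))) (by positivity : (0 : ℝ) ≤ Rw * (Csrc * (Cu * X)))
    (by positivity : (0 : ℝ) ≤ Bw * (Csrc * (Cu * X))) hG3 hMp3
  -- SUM by (P0) and the three-piece form (F2)
  have h123 := hax_sub F n K c₀ U₀ (w + (u - w)) (G (Tc (cs u))) (hax_add F n K c₀ U₀ w (u - w) h1 h2) h3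
  have hω := omega_one_three_pieces F hnK U₀ Q'' hseq ι T hT G hAG hGA hRS hker ha hp hΔs hΔ cs Tc hcompl x w
  intro ct yt yt' hy hy' hwin
  rw [hω]
  refine (h123 ct yt yt' hy hy' hwin).trans (le_of_eq ?_)
  congr 1
  rw [hX]
  ring

end Summit.QuantumFields.YangMills.Theorems.Prop7OmegaOneAxialHolderKnit

end
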